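import Literature.Analysis.FunctionSpaces.TorusFluidGlueProofs
import Literature.Analysis.FunctionSpaces.TorusFourierModes
import Literature.Analysis.FunctionSpaces.TorusSpaceTimeFields
import HarnessLib

/-!
# Classical Navier–Stokes solutions on `T^d` tested against single Fourier modes:
# time increments of the Fourier coefficients

Analysis/FluidPDE support file (theorem-only). For a classical solution `(u, p)` of the forced
incompressible Navier–Stokes system on `T^d × S` (`Torus.IsClassicalNSSolutionOn S ν f u p`,
`Literature.Analysis.FunctionSpaces.TorusFluidGlue`), `S` a convex time set, we test the momentum
equation against a *fixed* smooth divergence-free field `a` and against the single real Fourier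
modes `a = Re (e_k z)`, `k · z = 0`:

* `IsSmoothSpaceTimeOn.hasDerivWithinAt_integral_inner_const` — `d/dt ∫ ⟪u(t), a⟫ = ∫ ⟪∂ₜu(t), a⟫`
  for jointly smooth `u` (differentiation under the integral on the compact torus);
* `IsClassicalNSSolutionOn.integral_inner_timeDerivWithin_eq_of_isDivFree` — the tested momentum
  equation `∫ ⟪∂ₜu, a⟫ = ∫ ⟪u, (u·∇)a⟫ + ν ∫ ⟪u, Δa⟫ + ∫ ⟪f, a⟫` (antisymmetry of the trilinear
  form, Green's symmetry of `Δ`, and `∫ ⟪∇p, a⟫ = 0` for `div a = 0`; Temam 1984, Ch. III §1,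
  (1.12)–(1.13); Robinson–Rodrigo–Sadowski 2016, (3.2)–(3.3));
* `IsClassicalNSSolutionOn.hasDerivWithinAt_re_inner_mFourierCoeff` — the same in Fourier variables,
  `d/dt Re ⟪û(t,k), z⟫_ℂ = ∫ ⟪u, (u·∇)a⟫ + ν ∫ ⟪u, Δa⟫ + ∫ ⟪f, a⟫`, `a = Re (e_k z)`;
* `abs_modePairing_le` — the pointwise-in-time bound of the right-hand side by
  `‖z‖ (C_k ∫ ‖u‖² + |ν| 4π²|k|² ∫ ‖u‖ + ∫ ‖f‖)`, `C_k = #d · 2π|k|`;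
* `IsClassicalNSSolutionOn.norm_mFourierCoeff_sub_le` — **time increments of the Fourier
  coefficients**: for `s ≤ t` in `S`,
  `‖û(t,k) - û(s,k)‖ ≤ ∫ₛᵗ (C_k ∫ ‖u‖² + |ν| 4π²|k|² ∫ ‖u‖ + ∫ ‖f‖) dτ`
  (the coefficients of the divergence-free `u` are transversal, so the increment is recovered by
  testing against the transversal unit vector `z = (û(t,k) - û(s,k)) / ‖·‖`; fundamental theorem of
  calculus). This is the equicontinuity-in-time input of Aubin–Lions type compactness arguments
  carried out on the Fourier side (Robinson–Rodrigo–Sadowski 2016, Thm. 4.4 Step 3, (4.12)–(4.13),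
  there for Galerkin approximations; Hopf 1951, §4), here for smooth solutions, as used in the
  vanishing-viscosity compactness step of De Rosa–Isett 2024, §6.1.

## Mathlib search

Mathlib (this pin) has the calculus used here (`HasDerivWithinAt.inner`,
`intervalIntegral.integral_eq_sub_of_hasDerivAt_of_le`, `norm_integral_le_of_norm_le`) and the
multiple Fourier coefficients `UnitAddTorus.mFourierCoeff`; no Navier–Stokes notions. The torus
calculus, the trilinear antisymmetry `Torus.integral_inner_convect_eq_neg`, the single real modes
`Torus.realTrigPoly {k}` and the transversality `Torus.IsDivFree.sum_mul_mFourierCoeff_eq_zero`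
are the tree's.

## References

* R. Temam, *Navier–Stokes Equations*, 3rd ed. (North-Holland 1984), Ch. III §1, (1.12)–(1.13)
  (weak form tested against divergence-free fields). [Temam1984]
* J. C. Robinson, J. L. Rodrigo, W. Sadowski, *The Three-Dimensional Navier–Stokes Equations*
  (CUP 2016), (3.2)–(3.3), Thm. 4.4 Step 3, (4.12)–(4.13). [RobinsonRodrigoSadowski2016]
* L. De Rosa, P. Isett, Arch. Ration. Mech. Anal. 248 (2024), Paper No. 11 = arXiv:2212.08176,
  §6.1 (the Aubin–Lions–Simon step). [DeRosaIsett2024]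
-/

noncomputable section

open MeasureTheory Set Filter UnitAddTorus Function
open scoped ENNReal NNReal InnerProductSpace RealInnerProductSpace Topology

namespace Literature.Analysis.FluidPDE

open Literature.Analysis.FunctionSpaces Literature.Analysis.FunctionSpaces.Torus

variable {d : Type*} [Fintype d] [DecidableEq d]

/-! ## Pairing a jointly smooth field with a fixed smooth field -/

section Pairing

omit [DecidableEq d] in
/-- **Differentiation of a pairing under the integral**: for a jointly smooth field `u` on
`S × T^d` (`S` convex, of unique differentiability) and a fixed smooth field `a`,
`s ↦ ∫ ⟪u s, a⟫` has one-sided derivative `∫ ⟪∂ₜu(t), a⟫` within `S` at `t ∈ S`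
(`Torus.IsSmoothSpaceTimeOn.hasDerivWithinAt_integral` applied to `⟪u, a⟫`, Leibniz rule with
`∂ₜa = 0`). [folklore] -/
theorem _root_.Literature.Analysis.FunctionSpaces.Torus.IsSmoothSpaceTimeOn.hasDerivWithinAt_integral_inner_const
    {E : Type*} [NormedAddCommGroup E] [InnerProductSpace ℝ E]
    {S : Set ℝ} {u : ℝ → UnitAddTorus d → E} (hu : IsSmoothSpaceTimeOn S u) (hS : Convex ℝ S)
    (hU : UniqueDiffOn ℝ S) {a : UnitAddTorus d → E} (ha : IsSmooth a) {t : ℝ} (ht : t ∈ S) :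
    HasDerivWithinAt (fun s => ∫ x, ⟪u s x, a x⟫) (∫ x, ⟪timeDerivWithin S u t x, a x⟫) S t := by
  have hφ : IsSmoothSpaceTimeOn S (fun s x => ⟪u s x, a x⟫) :=
    hu.inner (isSmoothSpaceTimeOn_const ha S)
  have h := hφ.hasDerivWithinAt_integral hS ht
  have hpt : ∀ x, timeDerivWithin S (fun s x => ⟪u s x, a x⟫) t x =
      ⟪timeDerivWithin S u t x, a x⟫ := by
    intro x
    have h1 := ((hu.hasDerivWithinAt_slice ht x).inner ℝ
      (hasDerivWithinAt_const t S (a x))).derivWithin (hU t ht)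
    rw [inner_zero_right, zero_add] at h1
    exact h1
  simp_rw [hpt] at h
  exact h

end Pairing

/-! ## The momentum equation tested against a smooth divergence-free field -/

section Tested

variable {S : Set ℝ} {ν : ℝ} {f u : ℝ → UnitAddTorus d → EuclideanSpace ℝ d}
  {p : ℝ → UnitAddTorus d → ℝ}

/-- **The momentum equation tested against a smooth divergence-free field** (Temam 1984, Ch. III
§1, (1.12)–(1.13); Robinson–Rodrigo–Sadowski 2016, (3.2)–(3.3)): for a classical solution on
`S × T^d` and `t ∈ S`,
`∫ ⟪∂ₜu(t), a⟫ = ∫ ⟪u(t), (u(t)·∇)a⟫ + ν ∫ ⟪u(t), Δa⟫ + ∫ ⟪f(t), a⟫`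
(`∫ ⟪(u·∇)u, a⟫ = -∫ ⟪u, (u·∇)a⟫` by `Torus.integral_inner_convect_eq_neg`, `∫ ⟪Δu, a⟫ = ∫ ⟪u, Δa⟫`
by `Torus.integral_inner_laplacian_comm`, `∫ ⟪∇p, a⟫ = 0` by
`Torus.integral_inner_gradient_eq_zero_of_isDivFree`). [cite: Temam1984, Ch. III §1 (1.12)–(1.13)] -/
theorem _root_.Literature.Analysis.FunctionSpaces.Torus.IsClassicalNSSolutionOn.integral_inner_timeDerivWithin_eq_of_isDivFree
    (h : IsClassicalNSSolutionOn S ν f u p) (hU : UniqueDiffOn ℝ S)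
    {a : UnitAddTorus d → EuclideanSpace ℝ d} (ha : IsSmooth a) (hdiv : IsDivFree a)
    {t : ℝ} (ht : t ∈ S) :
    ∫ x, ⟪timeDerivWithin S u t x, a x⟫ =
      (∫ x, ⟪u t x, convect (u t) a x⟫) + ν * (∫ x, ⟪u t x, laplacian a x⟫) +
        ∫ x, ⟪f t x, a x⟫ := by
  have hut : IsSmooth (u t) := h.smooth_velocity.isSmooth_slice ht
  have hpt : IsSmooth (p t) := h.smooth_pressure.isSmooth_slice ht
  have hA : IsSmooth (timeDerivWithin S u t) := h.smooth_velocity.isSmooth_timeDerivWithin hU ht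
  have heq : ∀ x, timeDerivWithin S u t x =
      ν • laplacian (u t) x - gradient (p t) x + f t x - convect (u t) (u t) x := by
    intro x
    rw [← h.momentum t ht x]
    abel
  have hft : IsSmooth (f t) := by
    have h1 : IsSmooth (fun x => timeDerivWithin S u t x + convect (u t) (u t) x -
        ν • laplacian (u t) x + gradient (p t) x) :=
      ((hA.add (hut.convect hut)).sub (hut.laplacian.smul ν)).add hpt.gradient
    refine (congrArg IsSmooth (funext fun x => ?_)).mp h1
    rw [heq x]
    abel
  have iC : Integrable (fun x => ⟪convect (u t) (u t) x, a x⟫) volume :=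
    ((hut.convect hut).inner ha).integrable
  have iL : Integrable (fun x => ⟪ν • laplacian (u t) x, a x⟫) volume :=
    ((hut.laplacian.smul ν).inner ha).integrable
  have iG : Integrable (fun x => ⟪gradient (p t) x, a x⟫) volume := (hpt.gradient.inner ha).integrable
  have iF : Integrable (fun x => ⟪f t x, a x⟫) volume := (hft.inner ha).integrable
  have hL : ∫ x, ⟪ν • laplacian (u t) x, a x⟫ = ν * ∫ x, ⟪u t x, laplacian a x⟫ := by
    have hcomm : (fun x => ⟪ν • laplacian (u t) x, a x⟫) =
        fun x => ν * ⟪laplacian (u t) x, a x⟫ :=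
      funext fun x => by rw [real_inner_smul_left]
    rw [hcomm, integral_const_mul, integral_inner_laplacian_comm hut ha]
  have hGr : ∫ x, ⟪gradient (p t) x, a x⟫ = 0 :=
    integral_inner_gradient_eq_zero_of_isDivFree ha hpt hdiv
  have hC : ∫ x, ⟪convect (u t) (u t) x, a x⟫ = -∫ x, ⟪u t x, convect (u t) a x⟫ :=
    integral_inner_convect_eq_neg hut (h.divFree t ht) hut ha
  have i1 : Integrable (fun x => ⟪ν • laplacian (u t) x, a x⟫ - ⟪gradient (p t) x, a x⟫) volume :=
    iL.sub iG
  have i2 : Integrable (fun x => ⟪ν • laplacian (u t) x, a x⟫ - ⟪gradient (p t) x, a x⟫ +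
      ⟪f t x, a x⟫) volume := i1.add iF
  calc ∫ x, ⟪timeDerivWithin S u t x, a x⟫
      = ∫ x, (⟪ν • laplacian (u t) x, a x⟫ - ⟪gradient (p t) x, a x⟫ + ⟪f t x, a x⟫ -
          ⟪convect (u t) (u t) x, a x⟫) := by
        refine integral_congr_ae (ae_of_all _ fun x => ?_)
        show ⟪timeDerivWithin S u t x, a x⟫ = _
        rw [heq x]
        simp only [inner_add_left, inner_sub_left]
    _ = (∫ x, ⟪ν • laplacian (u t) x, a x⟫) - (∫ x, ⟪gradient (p t) x, a x⟫) +
          (∫ x, ⟪f t x, a x⟫) - ∫ x, ⟪convect (u t) (u t) x, a x⟫ := by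
        rw [integral_sub i2 iC, integral_add i1 iF, integral_sub iL iG]
    _ = _ := by
        rw [hL, hGr, hC]
        ring

/-- The pairing of a classical solution with a fixed smooth divergence-free field is
differentiable in time within `S` (convex, of unique differentiability), with derivative given
by the tested momentum equation:
`d/dt ∫ ⟪u(t), a⟫ = ∫ ⟪u, (u·∇)a⟫ + ν ∫ ⟪u, Δa⟫ + ∫ ⟪f, a⟫` (Temam 1984, Ch. III §1, (1.13)). [cite: Temam1984, Ch. III §1 (1.13)] -/
theorem _root_.Literature.Analysis.FunctionSpaces.Torus.IsClassicalNSSolutionOn.hasDerivWithinAt_integral_inner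
    (h : IsClassicalNSSolutionOn S ν f u p) (hS : Convex ℝ S) (hU : UniqueDiffOn ℝ S)
    {a : UnitAddTorus d → EuclideanSpace ℝ d} (ha : IsSmooth a) (hdiv : IsDivFree a)
    {t : ℝ} (ht : t ∈ S) :
    HasDerivWithinAt (fun s => ∫ x, ⟪u s x, a x⟫)
      ((∫ x, ⟪u t x, convect (u t) a x⟫) + ν * (∫ x, ⟪u t x, laplacian a x⟫) +
        ∫ x, ⟪f t x, a x⟫) S t := by
  rw [← h.integral_inner_timeDerivWithin_eq_of_isDivFree hU ha hdiv ht]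
  exact h.smooth_velocity.hasDerivWithinAt_integral_inner_const hS hU ha ht

/-- **The momentum equation in Fourier variables, tested against a single mode**: for a
classical solution on `S × T^d`, a frequency `k` and a transversal vector `z ∈ ℂ^d`
(`k · z = 0`, so that `a = Re (e_k z)` is smooth and divergence free),
`d/dt Re ⟪û(t,k), z⟫_ℂ = ∫ ⟪u, (u·∇)a⟫ + ν ∫ ⟪u, Δa⟫ + ∫ ⟪f, a⟫` within `S` at `t ∈ S`
(`∫ ⟪w, Re (e_k z)⟫ = Re ⟪ŵ(k), z⟫`, `Torus.integral_inner_realTrigPoly_singleton`;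
Robinson–Rodrigo–Sadowski 2016, (4.5)/(4.12) for Galerkin solutions). [cite: RobinsonRodrigoSadowski2016, Thm. 4.4 Step 3 (4.12)] -/
theorem _root_.Literature.Analysis.FunctionSpaces.Torus.IsClassicalNSSolutionOn.hasDerivWithinAt_re_inner_mFourierCoeff
    (h : IsClassicalNSSolutionOn S ν f u p) (hS : Convex ℝ S) (hU : UniqueDiffOn ℝ S)
    (k : d → ℤ) {z : EuclideanSpace ℂ d} (hz : ∑ j, (k j : ℂ) * z j = 0) {t : ℝ} (ht : t ∈ S) :
    HasDerivWithinAt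
      (fun s => (inner ℂ (mFourierCoeff (EuclideanSpace.complexify ∘ u s) k) z).re)
      ((∫ x, ⟪u t x, convect (u t) (realTrigPoly {k} fun _ => z) x⟫) +
        ν * (∫ x, ⟪u t x, laplacian (realTrigPoly {k} fun _ => z) x⟫) +
        ∫ x, ⟪f t x, realTrigPoly {k} (fun _ => z) x⟫) S t := by
  have ha : IsSmooth (realTrigPoly {k} fun _ => z) := isSmooth_realTrigPoly _ _
  have hdiv : IsDivFree (realTrigPoly {k} fun _ => z) := isDivFree_realTrigPoly_singleton hz
  refine (h.hasDerivWithinAt_integral_inner hS hU ha hdiv ht).congr (fun s hs => ?_) ?_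
  · exact (integral_inner_realTrigPoly_singleton
      ((h.smooth_velocity.isSmooth_slice hs).integrable) k (fun _ => z)).symm
  · exact (integral_inner_realTrigPoly_singleton
      ((h.smooth_velocity.isSmooth_slice ht).integrable) k (fun _ => z)).symm

end Tested

/-! ## The size of the tested right-hand side -/

section Bound

omit [DecidableEq d] in
/-- **Pointwise-in-time bound for the tested right-hand side against a single mode**
`a = Re (e_k z)`: for continuous `u`, integrable `F₀` and any real `ν`,
`|∫ ⟪u, (u·∇)a⟫ + ν ∫ ⟪u, Δa⟫ + ∫ ⟪F₀, a⟫| ≤ ‖z‖ (C_k ∫ ‖u‖² + |ν| 4π²|k|² ∫ ‖u‖ + ∫ ‖F₀‖)`,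
`C_k = #d · 2π |k|` (`‖a‖ ≤ ‖z‖`, `‖(u·∇)a‖ ≤ C_k ‖z‖ ‖u‖`, `Δa = -4π²|k|² a`). [folklore] -/
theorem abs_modePairing_le [DecidableEq d] {u F₀ : UnitAddTorus d → EuclideanSpace ℝ d}
    (hu : Continuous u) (hF : Integrable F₀ volume) (ν : ℝ) (k : d → ℤ) (z : EuclideanSpace ℂ d) :
    |(∫ x, ⟪u x, convect u (realTrigPoly {k} fun _ => z) x⟫) +
        ν * (∫ x, ⟪u x, laplacian (realTrigPoly {k} fun _ => z) x⟫) +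
        ∫ x, ⟪F₀ x, realTrigPoly {k} (fun _ => z) x⟫| ≤
      ‖z‖ * ((Fintype.card d * (2 * Real.pi * Real.sqrt (freqNormSq k))) * (∫ x, ‖u x‖ ^ 2) +
        |ν| * (4 * Real.pi ^ 2 * freqNormSq k) * (∫ x, ‖u x‖) + ∫ x, ‖F₀ x‖) := by
  set a := realTrigPoly {k} (fun _ => z) with ha
  have hax : ∀ x, ‖a x‖ ≤ ‖z‖ := fun x => norm_realTrigPoly_singleton_le k (fun _ => z) x
  have hi2 : Integrable (fun x => ‖u x‖ ^ 2) volume := (hu.norm.pow 2).integrable_unitAddTorus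
  have hi1 : Integrable (fun x => ‖u x‖) volume := hu.norm.integrable_unitAddTorus
  have hfk : 0 ≤ freqNormSq k := freqNormSq_nonneg k
  -- the convective term
  have h1 : |∫ x, ⟪u x, convect u a x⟫| ≤
      ‖z‖ * ((Fintype.card d * (2 * Real.pi * Real.sqrt (freqNormSq k))) * ∫ x, ‖u x‖ ^ 2) := by
    rw [← Real.norm_eq_abs, ← integral_const_mul, ← integral_const_mul]
    refine norm_integral_le_of_norm_le ((hi2.const_mul _).const_mul _) (ae_of_all _ fun x => ?_)
    refine (norm_inner_le_norm _ _).trans ?_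
    have hc := norm_convect_realTrigPoly_singleton_le u k (fun _ => z) x
    calc ‖u x‖ * ‖convect u a x‖
        ≤ ‖u x‖ * (‖u x‖ * (Fintype.card d * (2 * Real.pi * Real.sqrt (freqNormSq k) * ‖z‖))) :=
          mul_le_mul_of_nonneg_left hc (norm_nonneg _)
      _ = ‖z‖ * ((Fintype.card d * (2 * Real.pi * Real.sqrt (freqNormSq k))) * ‖u x‖ ^ 2) := by
          ring
  -- the viscous term
  have h2 : |ν * ∫ x, ⟪u x, laplacian a x⟫| ≤
      ‖z‖ * (|ν| * (4 * Real.pi ^ 2 * freqNormSq k) * ∫ x, ‖u x‖) := by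
    have hlap : (fun x => ⟪u x, laplacian a x⟫) =
        fun x => -(4 * Real.pi ^ 2 * freqNormSq k) * ⟪u x, a x⟫ := by
      funext x
      rw [ha, laplacian_realTrigPoly_singleton, inner_smul_right]
    rw [hlap, integral_const_mul, abs_mul, abs_mul, abs_neg,
      abs_of_nonneg (by positivity : (0 : ℝ) ≤ 4 * Real.pi ^ 2 * freqNormSq k)]
    have hin : |∫ x, ⟪u x, a x⟫| ≤ ‖z‖ * ∫ x, ‖u x‖ := by
      rw [← Real.norm_eq_abs, ← integral_const_mul]
      refine norm_integral_le_of_norm_le (hi1.const_mul _) (ae_of_all _ fun x => ?_)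
      calc ‖⟪u x, a x⟫‖ ≤ ‖u x‖ * ‖a x‖ := norm_inner_le_norm _ _
        _ ≤ ‖u x‖ * ‖z‖ := mul_le_mul_of_nonneg_left (hax x) (norm_nonneg _)
        _ = ‖z‖ * ‖u x‖ := mul_comm _ _
    calc |ν| * (4 * Real.pi ^ 2 * freqNormSq k * |∫ x, ⟪u x, a x⟫|)
        ≤ |ν| * (4 * Real.pi ^ 2 * freqNormSq k * (‖z‖ * ∫ x, ‖u x‖)) := by gcongr
      _ = ‖z‖ * (|ν| * (4 * Real.pi ^ 2 * freqNormSq k) * ∫ x, ‖u x‖) := by ring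
  -- the force term
  have h3 : |∫ x, ⟪F₀ x, a x⟫| ≤ ‖z‖ * ∫ x, ‖F₀ x‖ := by
    rw [← Real.norm_eq_abs, ← integral_const_mul]
    refine norm_integral_le_of_norm_le (hF.norm.const_mul _) (ae_of_all _ fun x => ?_)
    calc ‖⟪F₀ x, a x⟫‖ ≤ ‖F₀ x‖ * ‖a x‖ := norm_inner_le_norm _ _
      _ ≤ ‖F₀ x‖ * ‖z‖ := mul_le_mul_of_nonneg_left (hax x) (norm_nonneg _)
      _ = ‖z‖ * ‖F₀ x‖ := mul_comm _ _
  calc |(∫ x, ⟪u x, convect u a x⟫) + ν * (∫ x, ⟪u x, laplacian a x⟫) + ∫ x, ⟪F₀ x, a x⟫|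
      ≤ |∫ x, ⟪u x, convect u a x⟫| + |ν * ∫ x, ⟪u x, laplacian a x⟫| + |∫ x, ⟪F₀ x, a x⟫| :=
        (abs_add_le _ _).trans (add_le_add (abs_add_le _ _) le_rfl)
    _ ≤ _ := by
        have := add_le_add (add_le_add h1 h2) h3
        refine this.trans (le_of_eq ?_)
        ring

end Bound

/-! ## Time increments of the Fourier coefficients -/

section Increments

variable {S : Set ℝ} {ν : ℝ} {f u : ℝ → UnitAddTorus d → EuclideanSpace ℝ d}
  {p : ℝ → UnitAddTorus d → ℝ}

omit [DecidableEq d] in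
/-- A transversal unit vector recovering the norm: for `v ∈ ℂ^d`, `v ≠ 0`, transversal to `k`,
the vector `z = ‖v‖⁻¹ v` is transversal, has norm one, and `Re ⟪v, z⟫_ℂ = ‖v‖`. [folklore] -/
theorem exists_transversal_unit_re_inner_eq {k : d → ℤ} {v : EuclideanSpace ℂ d} (hv : v ≠ 0)
    (hk : ∑ j, (k j : ℂ) * v j = 0) :
    ∃ z : EuclideanSpace ℂ d, (∑ j, (k j : ℂ) * z j = 0) ∧ ‖z‖ = 1 ∧ (inner ℂ v z).re = ‖v‖ := by
  have hn : 0 < ‖v‖ := norm_pos_iff.2 hv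
  refine ⟨((‖v‖⁻¹ : ℝ) : ℂ) • v, ?_, ?_, ?_⟩
  · have : ∑ j, (k j : ℂ) * (((‖v‖⁻¹ : ℝ) : ℂ) • v) j = ((‖v‖⁻¹ : ℝ) : ℂ) * ∑ j, (k j : ℂ) * v j := by
      rw [Finset.mul_sum]
      refine Finset.sum_congr rfl fun j _ => ?_
      rw [PiLp.smul_apply, smul_eq_mul]
      ring
    rw [this, hk, mul_zero]
  · rw [norm_smul, Complex.norm_real, Real.norm_eq_abs, abs_of_pos (inv_pos.2 hn),
      inv_mul_cancel₀ hn.ne']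
  · have hre : (inner ℂ v v).re = ‖v‖ ^ 2 := by
      rw [← RCLike.re_to_complex]
      exact inner_self_eq_norm_sq (𝕜 := ℂ) v
    rw [inner_smul_right, Complex.re_ofReal_mul, hre, sq, ← mul_assoc, inv_mul_cancel₀ hn.ne',
      one_mul]

/-- **Time increments of the Fourier coefficients of a classical Navier–Stokes solution**
(Robinson–Rodrigo–Sadowski 2016, Thm. 4.4 Step 3, (4.12)–(4.13): "the time derivatives of the
coefficients are controlled by the energy bounds", there for Galerkin solutions; Hopf 1951, §4).
For a classical solution of the forced Navier–Stokes system on `S × T^d`, `S` convex, and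
`s ≤ t` in `S`, every Fourier coefficient satisfies
`‖û(t,k) - û(s,k)‖ ≤ ∫ₛᵗ (C_k ∫ ‖u(τ)‖² + |ν| 4π²|k|² ∫ ‖u(τ)‖ + ∫ ‖f(τ)‖) dτ`,
`C_k = #d · 2π|k|`. Proof: the coefficients of the divergence-free slices are transversal
(`Torus.IsDivFree.sum_mul_mFourierCoeff_eq_zero`), so `‖û(t,k) - û(s,k)‖ = Re ⟪û(t,k) - û(s,k), z⟫`
for a transversal unit `z`; the function `τ ↦ Re ⟪û(τ,k), z⟫` is differentiable within `S` with
derivative bounded by the integrand (`hasDerivWithinAt_re_inner_mFourierCoeff`,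
`abs_modePairing_le`), and the fundamental theorem of calculus on `[s, t] ⊆ S` concludes. [cite: RobinsonRodrigoSadowski2016, Thm. 4.4 Step 3 (4.12)–(4.13)] -/
theorem _root_.Literature.Analysis.FunctionSpaces.Torus.IsClassicalNSSolutionOn.norm_mFourierCoeff_sub_le
    (h : IsClassicalNSSolutionOn S ν f u p) (hS : Convex ℝ S) {s t : ℝ} (hs : s ∈ S) (ht : t ∈ S)
    (hst : s ≤ t) (k : d → ℤ) :
    ‖mFourierCoeff (EuclideanSpace.complexify ∘ u t) k -
        mFourierCoeff (EuclideanSpace.complexify ∘ u s) k‖ ≤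
      ∫ τ in s..t, ((Fintype.card d * (2 * Real.pi * Real.sqrt (freqNormSq k))) *
          (∫ x, ‖u τ x‖ ^ 2) + |ν| * (4 * Real.pi ^ 2 * freqNormSq k) * (∫ x, ‖u τ x‖) +
          ∫ x, ‖f τ x‖) := by
  set Ck : ℝ := Fintype.card d * (2 * Real.pi * Real.sqrt (freqNormSq k)) with hCk
  set g : ℝ → ℝ := fun τ => Ck * (∫ x, ‖u τ x‖ ^ 2) +
    |ν| * (4 * Real.pi ^ 2 * freqNormSq k) * (∫ x, ‖u τ x‖) + ∫ x, ‖f τ x‖ with hg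
  have hI : Icc s t ⊆ S := hS.ordConnected.out hs ht
  have hg0 : ∀ τ, 0 ≤ g τ := fun τ => by
    have h1 : 0 ≤ ∫ x, ‖u τ x‖ ^ 2 := integral_nonneg fun _ => by positivity
    have h2 : 0 ≤ ∫ x, ‖u τ x‖ := integral_nonneg fun _ => norm_nonneg _
    have h3 : 0 ≤ ∫ x, ‖f τ x‖ := integral_nonneg fun _ => norm_nonneg _
    have h4 : 0 ≤ freqNormSq k := freqNormSq_nonneg k
    positivity
  rcases eq_or_lt_of_le hst with rfl | hst'
  · simp
  -- `S` has nonempty interior, hence unique differentiability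
  have hU : UniqueDiffOn ℝ S := by
    refine uniqueDiffOn_convex hS ((nonempty_Ioo.2 hst').mono ?_)
    rw [← interior_Icc]
    exact interior_mono hI
  have hu := h.smooth_velocity
  have hf : IsSmoothSpaceTimeOn S f := by
    -- `f = ∂ₜu + (u·∇)u − νΔu + ∇p` on `S × T^d`, and the right-hand side is jointly smooth
    have hG : IsSmoothSpaceTimeOn S (fun t x => timeDerivWithin S u t x + convect (u t) (u t) x -
        ν • laplacian (u t) x + gradient (p t) x) :=
      (((hu.timeDerivWithin hU).add (hu.convect hu hU)).sub ((hu.laplacian hU).const_smul ν)).add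
        (h.smooth_pressure.gradient hU)
    refine ContDiffOn.congr hG fun z hz => ?_
    obtain ⟨τ, y⟩ := z
    have hτ : τ ∈ S := (mem_prod.1 hz).1
    simp only [stLift_apply]
    rw [h.momentum τ hτ (proj y)]
    abel
  set v : EuclideanSpace ℂ d := mFourierCoeff (EuclideanSpace.complexify ∘ u t) k -
    mFourierCoeff (EuclideanSpace.complexify ∘ u s) k with hv
  have hgi : IntervalIntegrable g volume s t := by
    have hc2 : ContinuousOn (fun τ => ∫ x, ‖u τ x‖ ^ 2) S :=
      continuousOn_integral_norm_sq_of_continuousOn_stLift hu.continuousOn_stLift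
    have hc1 : ContinuousOn (fun τ => ∫ x, ‖u τ x‖) S :=
      continuousOn_integral_of_continuousOn_stLift
        (continuous_norm.comp_continuousOn hu.continuousOn_stLift)
    have hc3 : ContinuousOn (fun τ => ∫ x, ‖f τ x‖) S :=
      continuousOn_integral_of_continuousOn_stLift
        (continuous_norm.comp_continuousOn hf.continuousOn_stLift)
    have hcg : ContinuousOn g S :=
      ((hc2.const_smul Ck).add (hc1.const_smul (|ν| * (4 * Real.pi ^ 2 * freqNormSq k)))).add hc3
    exact (hcg.mono (hI.trans' (uIcc_of_le hst).subset)).intervalIntegrable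
  by_cases hv0 : v = 0
  · rw [hv0, norm_zero]
    exact intervalIntegral.integral_nonneg hst fun τ _ => hg0 τ
  -- a transversal unit vector recovering `‖v‖`
  have hvk : ∑ j, (k j : ℂ) * v j = 0 := by
    have h1 := IsDivFree.sum_mul_mFourierCoeff_eq_zero (hu.isSmooth_slice ht) (h.divFree t ht) k
    have h2 := IsDivFree.sum_mul_mFourierCoeff_eq_zero (hu.isSmooth_slice hs) (h.divFree s hs) k
    have : ∑ j, (k j : ℂ) * v j = ∑ j, (k j : ℂ) * mFourierCoeff (EuclideanSpace.complexify ∘ u t) k j -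
        ∑ j, (k j : ℂ) * mFourierCoeff (EuclideanSpace.complexify ∘ u s) k j := by
      rw [← Finset.sum_sub_distrib]
      refine Finset.sum_congr rfl fun j _ => ?_
      rw [hv, PiLp.sub_apply, mul_sub]
    rw [this, h1, h2, sub_zero]
  obtain ⟨z, hz, hz1, hvz⟩ := exists_transversal_unit_re_inner_eq hv0 hvk
  -- the tested equation along `z`
  set φ : ℝ → ℝ := fun τ => (inner ℂ (mFourierCoeff (EuclideanSpace.complexify ∘ u τ) k) z).re
    with hφ
  set D : ℝ → ℝ := fun τ =>
    (∫ x, ⟪u τ x, convect (u τ) (realTrigPoly {k} fun _ => z) x⟫) +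
      ν * (∫ x, ⟪u τ x, laplacian (realTrigPoly {k} fun _ => z) x⟫) +
      ∫ x, ⟪f τ x, realTrigPoly {k} (fun _ => z) x⟫ with hD
  have hderiv : ∀ τ ∈ S, HasDerivWithinAt φ (D τ) S τ := fun τ hτ =>
    h.hasDerivWithinAt_re_inner_mFourierCoeff hS hU k hz hτ
  have ha : IsSmooth (realTrigPoly {k} fun _ => z) := isSmooth_realTrigPoly _ _
  have hDc : ContinuousOn D S := by
    have h1 : ContinuousOn (fun τ => ∫ x, ⟪u τ x, convect (u τ) (realTrigPoly {k} fun _ => z) x⟫) S :=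
      (hu.inner (hu.convect (isSmoothSpaceTimeOn_const ha S) hU)).continuousOn_integral hS
    have h2 : ContinuousOn (fun τ => ∫ x, ⟪u τ x, laplacian (realTrigPoly {k} fun _ => z) x⟫) S :=
      (hu.inner (isSmoothSpaceTimeOn_const ha.laplacian S)).continuousOn_integral hS
    have h3 : ContinuousOn (fun τ => ∫ x, ⟪f τ x, realTrigPoly {k} (fun _ => z) x⟫) S :=
      (hf.inner (isSmoothSpaceTimeOn_const ha S)).continuousOn_integral hS
    exact (h1.add (h2.const_smul ν)).add h3
  have hDi : IntervalIntegrable D volume s t :=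
    (hDc.mono (hI.trans' (uIcc_of_le hst).subset)).intervalIntegrable
  have hFTC : ∫ τ in s..t, D τ = φ t - φ s :=
    intervalIntegral.integral_eq_sub_of_hasDerivAt_of_le hst
      (fun τ hτ => ((hderiv τ (hI hτ)).continuousWithinAt).mono hI)
      (fun τ hτ => (hderiv τ (hI (Ioo_subset_Icc_self hτ))).hasDerivAt
        (mem_of_superset (Icc_mem_nhds hτ.1 hτ.2) hI))
      hDi
  -- `|D| ≤ g` on `[s, t]`
  have hDg : ∀ τ ∈ Icc s t, D τ ≤ g τ := by
    intro τ hτ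
    have hτS := hI hτ
    have hb := abs_modePairing_le ((hu.isSmooth_slice hτS).continuous)
      ((hf.isSmooth_slice hτS).integrable) ν k z
    rw [hz1, one_mul] at hb
    exact (le_abs_self _).trans hb
  have hφv : φ t - φ s = ‖v‖ := by
    rw [← hvz, hv, inner_sub_left, Complex.sub_re]
  calc ‖v‖ = ∫ τ in s..t, D τ := by rw [hFTC, hφv]
    _ ≤ ∫ τ in s..t, g τ := intervalIntegral.integral_mono_on hst hDi hgi hDg

end Increments

end Literature.Analysis.FluidPDE

end
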